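import Summits.QuantumFields.BalabanUV.T4Continuum.Spine.NE3.FlatLandauGaugeBond
import HarnessLib

/-!
# T⁴ programme, node NE3 — [B8] AT A CURVED BACKGROUND, brick E′, letter 2a′: the ABSTRACT PURE-GAUGE LEMMA
# `‖Σᵢ log(e^X e^{−νᵢ}) − Σᵢ(X − νᵢ)‖ ≤ 4Λ‖Σᵢ(X − νᵢ)‖ + 7·#s·γ²` and the COVARIANT letters at a unitary background `W`
# (`Δ_Wλ` as the sum of the `2d` covariant increments; the conjugation part of the divergence junk) — LETTERS (`CurvedLandauGaugeLetters`)

Cell `pub-balaban`, rung (B)+1 sub-cell t4, row NE3 (OWNER lineage `b2b-balaban-t4-ne3-p1`, generation 27; technique of record: implicit-function ∕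
contraction mapping).  The CURVED twin of letter 2b `Spine/NE3/FlatLandauGaugeStep` of the chain «BRICK E OF REP♭ AT FLAT PAIRS»: the same one-step
identity-with-remainder at an ARBITRARY unitary background `W` (no smallness of `W` is used), i.e. the linearisation of the Landau map of
[Balaban1985RegularSpaces] («B8») Sect. E (1.94)–(1.100) at `U₀ = W` — the step towards Prop. 5 ∕ Thm 2's gauge-existence AT THE MINIMISER PAIR
(`PairLandauB8.PairLandauGaugeB8`, census `pub-balaban-gaps/ne/NE3.md` R4), where the background is `W = cavg L U_B`, not `1`.

THE STEP.  `W` unitary; `V` unitary with relative variables `R(b) := W(b)⁻¹V(b)`, `‖R(b) − 1‖ ≤ r ≤ 1∕20`, relative potential `Z := log R` (so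
`V = vary W Z 1 = W·e^{Z}`); a skew site field `λ` with `‖λ‖ ≤ Λ ≤ 1∕10` and COVARIANT oscillation `‖D_W λ‖ ≤ γ ≤ 1∕25`
(`D_W λ (y, μ) = gaugeDir W λ y μ = Ad_{W(y,μ)⁻¹} λ(y) − λ(y + e_μ)`); the gauge transformation `w = e^{λ}`; `V′ := V^{w}`, `Z′ := log W⁻¹V′`.  Then at
every site `x`:  `‖covDiv_W Z′(x) − covDiv_W Z(x) − Δ_W λ(x)‖ ≤ 4Λ·(‖covDiv_W Z(x)‖ + ‖Δ_W λ(x)‖) + 25·d·r·γ + 14·d·γ²`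
(`covDiv_W` = `NE3CovariantWeitzenbock.covDiv W`, `Δ_W` = `PairLandauB8.covLapSite W` = `covDiv_W ∘ D_W`).  MECHANISM: on the bond `(x, μ)`,
`W⁻¹V′ = w̃·R·w′⁻¹` with the TRANSPORTED gauge `w̃ := W⁻¹w(x)W = e^{Ad_{W⁻¹}λ(x)}` and `w′ := w(x + e_μ)` — literally the flat bond of letter 2a with
`(u, u′) := (w̃, w′)`, `‖w̃ − w′‖ ≤ (5∕4)‖D_Wλ(x,μ)‖`; the pure-gauge part is the abstract star lemma of §1 over the `2d` COVARIANT neighbours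
`Ad_{W(x,μ)}λ(x+e_μ)`, `Ad_{W(x−e_μ,μ)⁻¹}λ(x−e_μ)` of `λ(x)`, whose increments sum to `Δ_Wλ(x)` EXACTLY.

WHAT ([folklore]; `d` any, `n : Type*` nonempty finite; 0 def, 0 sorry; the junk bound itself is letter 2b′ `Spine/NE3/CurvedLandauGaugeStep`):
* §1 `norm_exp_sub_exp_le'` (`‖e^X − e^Y‖ ≤ (5∕4)‖X − Y‖` on the `1∕10`-ball); **`norm_sum_mlog_pureGauge_abstract_le`** — for `X`, `νᵢ` in the
  `Λ`-ball, skew, `‖X − νᵢ‖ ≤ γ`: `‖Σᵢ log(e^X e^{−νᵢ}) − Σᵢ (X − νᵢ)‖ ≤ 4Λ‖Σᵢ(X − νᵢ)‖ + 7·#s·γ²` (second-order logarithm + the star lemma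
  `FlatLandauExpStar.norm_starSum_exp_le` with base point `−X`).
* §2 `Ad_mul'`, `Ad_Ad_inv'`, `covLapSite_eq_sum_neighbours` (`Δ_Wλ(x) = Σ_μ [(λ x − Ad_{W(x,μ)}λ(x+e_μ)) + (λ x − Ad_{W(x−e_μ,μ)⁻¹}λ(x−e_μ))]`),
  `norm_sum_Ad_sub_covDiv_W_le` (the conjugation part of the junk at `W`).

HONEST FRAMING (page 1): elementary lattice ∕ Banach-algebra analysis of OUR objects; `W` is an arbitrary unitary background; nothing of Bałaban's is used,
asserted or discharged; the curved brick E′ (the exact (1.38)-Landau representative relative to `W` with sup member) is NOT landed by this file (it needs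
the curved Newton step + scheme + limit over the curved letters (H0_W) `SupRegularityCurvedUniform.supRegularity_uniform` and (HR_W)
`LandauProjectionSupCurvedUniform.covLapSite_sup_le_curved_uniform`, both PROVED, level-free); `PairLandauGaugeB8` ∕ NE3 ∕ NE7 NOT proved; spine PROVED
0∕9; finite T⁴ rung (B)+1 — NOT infinite volume, NOT mass gap, NOT `BetaPertH`, NOT Clay.  Continuum YM on T⁴ ⇐ BetaPertH ∧ nine spine estimates (0/9
proved); BetaPertH ⇐ (D1) ∧ (D4) ∧ CAP+tail; G-an2-4 gates asym, D1 and NE2/3/4.  PLACEMENT: our lemma, `Spine/NE3/`; imports letter 2a only.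
-/

set_option autoImplicit false

open NormedSpace
open scoped BigOperators Matrix.Norms.L2Operator
open Finset

namespace Summit.QuantumFields.BalabanUV.T4Continuum.NE3.CurvedLandauGaugeLetters

open Literature.MathematicalPhysics.QuantumFieldTheory.Balaban1983to89
open B7Prop1Explicit B7Prop2Explicit MatrixLog
open T4AveragingDeficitWall (Ad IsUnitaryCfg IsSkewDir)
open T4AveragingDeficitWallBoundary (IsPeriodicCfg periodBox)
open AveragingDeficitPeriodicCounting (IsPeriodicDir)
open AveragingDeficitNearIdentity (norm_Ad_sub_le)
open AveragingDeficitTransport (norm_Ad_of_unitary mem_U1_of_unitary)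
open NE3EnergyShapes (IsUnitarySite IsPeriodicSite)
open NE3CovariantWeitzenbock (covDiv)
open NE3.PairLandauB8 (covLapSite)
open NE3.LandauProjectionB8 (covDiv_gaugeDir_eq_covLapSite)
open BlockAveragePushDirGauge (gaugeDir)
open NE7ExpLogSecondOrder (norm_expTail_sub_expTail_le real_exp_sub_one_le_two_mul)
open NE3.FlatLandauExpStar (norm_starSum_exp_le)
open NE3.FlatLandauGaugeBond

noncomputable section

variable {d : ℕ} {n : Type*} [Fintype n] [DecidableEq n]

/-! ## §1 The abstract pure-gauge lemma -/

section Abstract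

variable [Nonempty n]

/-- `‖e^X − e^Y‖ ≤ (5∕4)‖X − Y‖` for `‖X‖, ‖Y‖ ≤ Λ ≤ 1∕10` (tail Lipschitz bound + `e^{1∕10} ≤ 5∕4`). [folklore] -/
theorem norm_exp_sub_exp_le' {X Y : Matrix n n ℂ} {Λ : ℝ} (hX : ‖X‖ ≤ Λ) (hY : ‖Y‖ ≤ Λ) (hΛ1 : Λ ≤ 1 / 10) :
    ‖exp X - exp Y‖ ≤ 5 / 4 * ‖X - Y‖ := by
  have hT := norm_expTail_sub_expTail_le hX hY
  have hid : exp X - exp Y = (X - Y) + ((exp X - 1 - X) - (exp Y - 1 - Y)) := by abel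
  rw [hid]
  have hE : Real.exp Λ ≤ 5 / 4 := (Real.exp_le_exp.mpr hΛ1).trans exp_tenth_le
  calc ‖(X - Y) + ((exp X - 1 - X) - (exp Y - 1 - Y))‖ ≤ ‖X - Y‖ + (Real.exp Λ - 1) * ‖X - Y‖ :=
        (norm_add_le _ _).trans (add_le_add le_rfl hT)
    _ = Real.exp Λ * ‖X - Y‖ := by ring
    _ ≤ 5 / 4 * ‖X - Y‖ := mul_le_mul_of_nonneg_right hE (norm_nonneg _)

/-- **THE ABSTRACT PURE-GAUGE LEMMA**: for skew `X` and a finite family of skew `νᵢ` in the `Λ`-ball (`Λ ≤ 1∕10`) with `‖X − νᵢ‖ ≤ γ ≤ 1∕25`,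
`‖Σᵢ log(e^{X}e^{−νᵢ}) − Σᵢ (X − νᵢ)‖ ≤ 4Λ·‖Σᵢ (X − νᵢ)‖ + 7·#s·γ²` — second-order logarithm on each `gᵢ = e^Xe^{−νᵢ}` (`‖gᵢ − 1‖ ≤ (5∕4)γ`), then the
star lemma `FlatLandauExpStar.norm_starSum_exp_le` on `Σᵢ (e^{−νᵢ} − e^{−X})` with base point `−X` and increments `X − νᵢ`. [folklore] -/
theorem norm_sum_mlog_pureGauge_abstract_le {ι : Type*} (s : Finset ι) {X : Matrix n n ℂ} (hXs : X ∈ skewAdjoint (Matrix n n ℂ))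
    {ν : ι → Matrix n n ℂ} (hνs : ∀ i ∈ s, ν i ∈ skewAdjoint (Matrix n n ℂ)) {Λ γ : ℝ} (hX : ‖X‖ ≤ Λ) (hν : ∀ i ∈ s, ‖ν i‖ ≤ Λ)
    (hΛ1 : Λ ≤ 1 / 10) (hγ : ∀ i ∈ s, ‖X - ν i‖ ≤ γ) (hγ0 : 0 ≤ γ) (hγ1 : γ ≤ 1 / 25) :
    ‖∑ i ∈ s, mlog (exp X * exp (-ν i)) - ∑ i ∈ s, (X - ν i)‖ ≤ 4 * Λ * ‖∑ i ∈ s, (X - ν i)‖ + 7 * s.card * γ ^ 2 := by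
  letI : NormedAlgebra ℚ (Matrix n n ℂ) := NormedAlgebra.restrictScalars ℚ ℝ (Matrix n n ℂ)
  have hΛ0 : 0 ≤ Λ := (norm_nonneg _).trans hX
  have hE : Real.exp Λ ≤ 5 / 4 := (Real.exp_le_exp.mpr hΛ1).trans exp_tenth_le
  have hE1 : Real.exp Λ - 1 ≤ 2 * Λ := real_exp_sub_one_le_two_mul hΛ0 (by linarith)
  -- `u := e^X` unitary, `e^X e^{−X} = 1`
  have huU : exp X ∈ unitary (Matrix n n ℂ) := NormedSpace.exp_mem_unitary_of_mem_skewAdjoint hXs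
  have hu1 : ‖exp X‖ = 1 := CStarRing.norm_of_mem_unitary huU
  have hσ : ‖exp X - 1‖ ≤ 2 * Λ := (norm_exp_sub_one_le_of_norm_le hX).1.trans hE1
  have hXX : exp X * exp (-X) = 1 := by
    rw [← exp_add_of_commute (Commute.refl X).neg_right, add_neg_cancel, exp_zero]
  have hνν : ∀ i ∈ s, exp (ν i) * exp (-ν i) = 1 := fun i _ => by
    rw [← exp_add_of_commute (Commute.refl (ν i)).neg_right, add_neg_cancel, exp_zero]
  have hνu : ∀ i ∈ s, ‖exp (-ν i)‖ = 1 := fun i hi =>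
    CStarRing.norm_of_mem_unitary (NormedSpace.exp_mem_unitary_of_mem_skewAdjoint ((skewAdjoint _).neg_mem (hνs i hi)))
  -- `gᵢ − 1 = (e^X − e^{νᵢ}) e^{−νᵢ}`, `‖gᵢ − 1‖ ≤ (5∕4)γ`
  have hg : ∀ i ∈ s, ‖exp X * exp (-ν i) - 1‖ ≤ 5 / 4 * γ := by
    intro i hi
    have hid : exp X * exp (-ν i) - 1 = (exp X - exp (ν i)) * exp (-ν i) := by rw [sub_mul, hνν i hi]
    rw [hid]
    calc _ ≤ ‖exp X - exp (ν i)‖ * ‖exp (-ν i)‖ := norm_mul_le _ _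
      _ ≤ 5 / 4 * ‖X - ν i‖ * 1 := by rw [hνu i hi]; exact mul_le_mul_of_nonneg_right (norm_exp_sub_exp_le' hX (hν i hi) hΛ1) zero_le_one
      _ ≤ 5 / 4 * γ := by linarith [hγ i hi]
  have hq : ∀ i ∈ s, ‖mlog (exp X * exp (-ν i)) - (exp X * exp (-ν i) - 1)‖ ≤ (5 / 2 * γ) ^ 2 := by
    intro i hi
    have h1 := norm_mlog_sub_le (W := exp X * exp (-ν i)) ((hg i hi).trans (by linarith))
    exact h1.trans ((expRem_mono (by positivity) (by linarith [hg i hi] : 2 * ‖exp X * exp (-ν i) - 1‖ ≤ 5 / 2 * γ)).trans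
      (expRem_le_sq (by positivity) (by linarith)))
  -- the star lemma on `S := Σᵢ (e^{−νᵢ} − e^{−X})`
  set S : Matrix n n ℂ := ∑ i ∈ s, (exp (-ν i) - exp (-X)) with hS
  set Lap : Matrix n n ℂ := ∑ i ∈ s, (X - ν i) with hLap
  have hstar : ‖S - Lap‖ ≤ (Real.exp Λ - 1) * ‖Lap‖ + Real.exp Λ * (s.card * γ ^ 2 / 2) := by
    have h := norm_starSum_exp_le s (X := -X) (Y := fun i => X - ν i) (ρ := Λ) (δ := ‖Lap‖) (σ := s.card * γ ^ 2)
      (by rw [norm_neg]; exact hX)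
      (fun i hi => by rw [show -X + (X - ν i) = -ν i by abel, norm_neg]; exact hν i hi)
      (by rw [hLap])
      (by
        calc ∑ i ∈ s, ‖X - ν i‖ ^ 2 ≤ ∑ _i ∈ s, γ ^ 2 := Finset.sum_le_sum fun i hi => pow_le_pow_left₀ (norm_nonneg _) (hγ i hi) 2
          _ = s.card * γ ^ 2 := by rw [Finset.sum_const, nsmul_eq_mul])
    have hS' : ∑ i ∈ s, (exp (-X + (X - ν i)) - exp (-X)) = S := by
      rw [hS]; exact Finset.sum_congr rfl fun i _ => by rw [show -X + (X - ν i) = -ν i by abel]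
    rw [hS'] at h
    exact h
  -- `Σᵢ (gᵢ − 1) = e^X · S`
  have hsum1 : ∑ i ∈ s, (exp X * exp (-ν i) - 1) = exp X * S := by
    rw [hS, Finset.mul_sum]
    exact Finset.sum_congr rfl fun i _ => by rw [mul_sub, hXX]
  -- decomposition `Q + ((e^X − 1)·Lap + e^X·(S − Lap))`
  have hid : ∑ i ∈ s, mlog (exp X * exp (-ν i)) - Lap
      = ∑ i ∈ s, (mlog (exp X * exp (-ν i)) - (exp X * exp (-ν i) - 1)) + ((exp X - 1) * Lap + exp X * (S - Lap)) := by
    have h3 : (exp X - 1) * Lap + exp X * (S - Lap) = exp X * S - Lap := by noncomm_ring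
    have h4 : ∑ i ∈ s, mlog (exp X * exp (-ν i)) = ∑ i ∈ s, (mlog (exp X * exp (-ν i)) - (exp X * exp (-ν i) - 1))
        + ∑ i ∈ s, (exp X * exp (-ν i) - 1) := by
      rw [← Finset.sum_add_distrib]; exact Finset.sum_congr rfl fun i _ => by abel
    rw [h3, h4, hsum1]; abel
  rw [hid]
  have hQ : ‖∑ i ∈ s, (mlog (exp X * exp (-ν i)) - (exp X * exp (-ν i) - 1))‖ ≤ s.card * (5 / 2 * γ) ^ 2 := by
    calc _ ≤ ∑ i ∈ s, (5 / 2 * γ) ^ 2 := (norm_sum_le _ _).trans (Finset.sum_le_sum fun i hi => hq i hi)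
      _ = s.card * (5 / 2 * γ) ^ 2 := by rw [Finset.sum_const, nsmul_eq_mul]
  have hR : ‖(exp X - 1) * Lap + exp X * (S - Lap)‖ ≤ 2 * Λ * ‖Lap‖ + ((2 * Λ) * ‖Lap‖ + 5 / 4 * (s.card * γ ^ 2 / 2)) := by
    calc _ ≤ ‖exp X - 1‖ * ‖Lap‖ + ‖exp X‖ * ‖S - Lap‖ := (norm_add_le _ _).trans (add_le_add (norm_mul_le _ _) (norm_mul_le _ _))
      _ ≤ 2 * Λ * ‖Lap‖ + 1 * ((Real.exp Λ - 1) * ‖Lap‖ + Real.exp Λ * (s.card * γ ^ 2 / 2)) := by rw [hu1]; gcongr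
      _ ≤ 2 * Λ * ‖Lap‖ + 1 * ((2 * Λ) * ‖Lap‖ + 5 / 4 * (s.card * γ ^ 2 / 2)) := by gcongr
      _ = _ := by ring
  have hc0 : (0 : ℝ) ≤ s.card := Nat.cast_nonneg _
  calc _ ≤ s.card * (5 / 2 * γ) ^ 2 + (2 * Λ * ‖Lap‖ + ((2 * Λ) * ‖Lap‖ + 5 / 4 * (s.card * γ ^ 2 / 2))) :=
        (norm_add_le _ _).trans (add_le_add hQ hR)
    _ ≤ 4 * Λ * ‖Lap‖ + 7 * s.card * γ ^ 2 := by nlinarith [mul_nonneg hc0 (sq_nonneg γ)]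

end Abstract

/-! ## §2 Covariant letters at a unitary background `W` -/

section Covariant

variable [Nonempty n]

omit [Nonempty n] in
/-- `Ad_{ab} = Ad_a ∘ Ad_b`. [folklore] -/
theorem Ad_mul' (a b : (Matrix n n ℂ)ˣ) (X : Matrix n n ℂ) : Ad (a * b) X = Ad a (Ad b X) := by
  simp only [Ad, Units.val_mul, mul_inv_rev, mul_assoc]

omit [Nonempty n] in
/-- `Ad_a (Ad_{a⁻¹} X) = X`. [folklore] -/
theorem Ad_Ad_inv' (a : (Matrix n n ℂ)ˣ) (X : Matrix n n ℂ) : Ad a (Ad a⁻¹ X) = X := by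
  rw [← Ad_mul', mul_inv_cancel]; simp [Ad]

omit [Nonempty n] in
/-- **`Δ_W λ(x)` AS THE SUM OF THE `2d` COVARIANT INCREMENTS**: `covLapSite W λ x = Σ_μ [(λ x − Ad_{W(x,μ)} λ(x+e_μ)) + (λ x − Ad_{W(x−e_μ,μ)⁻¹} λ(x−e_μ))]`
(`Δ_W = covDiv_W ∘ D_W`, `LandauProjectionB8.covDiv_gaugeDir_eq_covLapSite`). [folklore] -/
theorem covLapSite_eq_sum_neighbours (W : Site d → Fin d → (Matrix n n ℂ)ˣ) (lam : Site d → Matrix n n ℂ) (x : Site d) :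
    covLapSite W lam x = ∑ μ : Fin d, ((lam x - Ad (W x μ) (lam (x + e μ))) + (lam x - Ad (W (x - e μ) μ)⁻¹ (lam (x - e μ)))) := by
  rw [← congrFun (covDiv_gaugeDir_eq_covLapSite W lam) x]
  unfold covDiv
  refine Finset.sum_congr rfl fun μ _ => ?_
  have h1 : Ad (W x μ) (gaugeDir W lam x μ) = lam x - Ad (W x μ) (lam (x + e μ)) := by
    unfold gaugeDir; rw [show Ad (W x μ)⁻¹ (lam x) - lam (x + e μ) = Ad (W x μ)⁻¹ (lam x) + (-lam (x + e μ)) by abel,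
      AveragingDeficitNearIdentity.Ad_add, Ad_Ad_inv', AveragingDeficitNearIdentity.Ad_neg]; abel
  have h2 : gaugeDir W lam (x - e μ) μ = Ad (W (x - e μ) μ)⁻¹ (lam (x - e μ)) - lam x := by
    unfold gaugeDir; rw [sub_add_cancel]
  rw [h1, h2]; abel

/-- **THE CONJUGATION PART AT `W`**: for a unitary site gauge `w` and its transports `w̃(y, μ) := W(y,μ)⁻¹ w(y) W(y,μ)`, with `‖w − 1‖ ≤ σ` and the backward
covariant oscillation `‖w(x) − w̃(x−e_μ, μ)‖ ≤ γ_u`, and a bond field `‖Z‖ ≤ z`: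
`‖Σ_μ (Ad_{W(x,μ)}Ad_{w̃(x,μ)} Z(x,μ) − Ad_{w̃(x−e_μ,μ)} Z(x−e_μ,μ)) − covDiv_W Z(x)‖ ≤ 2σ‖covDiv_W Z(x)‖ + 2·d·γ_u·z`. [folklore] -/
theorem norm_sum_Ad_sub_covDiv_W_le {W : Site d → Fin d → (Matrix n n ℂ)ˣ} {w : Site d → (Matrix n n ℂ)ˣ} (hwU : IsUnitarySite w)
    (hWu : IsUnitaryCfg W) {σ γu z : ℝ} (hσ : ∀ y, ‖(w y : Matrix n n ℂ) - 1‖ ≤ σ)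
    (hγu : ∀ (y : Site d) (μ : Fin d), ‖(w y : Matrix n n ℂ) - (((W (y - e μ) μ)⁻¹ * w (y - e μ) * W (y - e μ) μ : (Matrix n n ℂ)ˣ) : Matrix n n ℂ)‖ ≤ γu)
    {Z : Site d → Fin d → Matrix n n ℂ} (hz : ∀ y μ, ‖Z y μ‖ ≤ z) (x : Site d) :
    ‖∑ μ : Fin d, (Ad (W x μ) (Ad ((W x μ)⁻¹ * w x * W x μ) (Z x μ)) - Ad ((W (x - e μ) μ)⁻¹ * w (x - e μ) * W (x - e μ) μ) (Z (x - e μ) μ))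
        - covDiv W Z x‖ ≤ 2 * σ * ‖covDiv W Z x‖ + 2 * d * γu * z := by
  have hAdsub : ∀ (v : (Matrix n n ℂ)ˣ) (X Y : Matrix n n ℂ), Ad v (X - Y) = Ad v X - Ad v Y := fun v X Y => by unfold Ad; noncomm_ring
  have hconj : ∀ μ : Fin d, Ad (W x μ) (Ad ((W x μ)⁻¹ * w x * W x μ) (Z x μ)) = Ad (w x) (Ad (W x μ) (Z x μ)) := fun μ => by
    rw [← Ad_mul', ← Ad_mul', show W x μ * ((W x μ)⁻¹ * w x * W x μ) = w x * W x μ by group]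
  have htU : ∀ μ : Fin d, ((W (x - e μ) μ)⁻¹ * w (x - e μ) * W (x - e μ) μ : (Matrix n n ℂ)ˣ) ∈ unitaryUnits (Matrix n n ℂ) := fun μ =>
    (unitaryUnits _).mul_mem ((unitaryUnits _).mul_mem ((unitaryUnits _).inv_mem (hWu _ _)) (hwU _)) (hWu _ _)
  have hcd : Ad (w x) (covDiv W Z x) = ∑ μ : Fin d, (Ad (w x) (Ad (W x μ) (Z x μ)) - Ad (w x) (Z (x - e μ) μ)) := by
    unfold covDiv; rw [AveragingDeficitNearIdentity.Ad_sum]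
    exact Finset.sum_congr rfl fun μ _ => hAdsub _ _ _
  have hid : ∑ μ : Fin d, (Ad (W x μ) (Ad ((W x μ)⁻¹ * w x * W x μ) (Z x μ)) - Ad ((W (x - e μ) μ)⁻¹ * w (x - e μ) * W (x - e μ) μ) (Z (x - e μ) μ))
        - covDiv W Z x
      = (Ad (w x) (covDiv W Z x) - covDiv W Z x)
        + ∑ μ : Fin d, (Ad (w x) (Z (x - e μ) μ) - Ad ((W (x - e μ) μ)⁻¹ * w (x - e μ) * W (x - e μ) μ) (Z (x - e μ) μ)) := by
    have h1 : ∑ μ : Fin d, (Ad (W x μ) (Ad ((W x μ)⁻¹ * w x * W x μ) (Z x μ))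
          - Ad ((W (x - e μ) μ)⁻¹ * w (x - e μ) * W (x - e μ) μ) (Z (x - e μ) μ))
        = ∑ μ : Fin d, (Ad (w x) (Ad (W x μ) (Z x μ)) - Ad (w x) (Z (x - e μ) μ))
          + ∑ μ : Fin d, (Ad (w x) (Z (x - e μ) μ) - Ad ((W (x - e μ) μ)⁻¹ * w (x - e μ) * W (x - e μ) μ) (Z (x - e μ) μ)) := by
      rw [← Finset.sum_add_distrib]
      exact Finset.sum_congr rfl fun μ _ => by rw [hconj μ]; abel
    have h2 : covDiv W Z x = ∑ μ : Fin d, (Ad (W x μ) (Z x μ) - Z (x - e μ) μ) := rfl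
    rw [h1, hcd, h2]
    abel
  rw [hid]
  have h1 : ‖Ad (w x) (covDiv W Z x) - covDiv W Z x‖ ≤ 2 * σ * ‖covDiv W Z x‖ :=
    (norm_Ad_sub_le (hwU x) _).trans (by gcongr; exact hσ x)
  have h2 : ‖∑ μ : Fin d, (Ad (w x) (Z (x - e μ) μ) - Ad ((W (x - e μ) μ)⁻¹ * w (x - e μ) * W (x - e μ) μ) (Z (x - e μ) μ))‖
      ≤ 2 * d * γu * z := by
    calc _ ≤ ∑ μ : Fin d, 2 * ‖(w x : Matrix n n ℂ) - (((W (x - e μ) μ)⁻¹ * w (x - e μ) * W (x - e μ) μ : (Matrix n n ℂ)ˣ) : Matrix n n ℂ)‖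
          * ‖Z (x - e μ) μ‖ := (norm_sum_le _ _).trans (Finset.sum_le_sum fun μ _ => norm_Ad_sub_Ad_le (hwU x) (htU μ) _)
      _ ≤ ∑ _μ : Fin d, 2 * γu * z := Finset.sum_le_sum fun μ _ =>
          mul_le_mul (mul_le_mul_of_nonneg_left (hγu x μ) two_pos.le) (hz _ _) (norm_nonneg _)
            (by linarith [norm_nonneg ((w x : Matrix n n ℂ) - (((W (x - e μ) μ)⁻¹ * w (x - e μ) * W (x - e μ) μ : (Matrix n n ℂ)ˣ) : Matrix n n ℂ)),
              hγu x μ])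
      _ = 2 * d * γu * z := by simp; ring
  exact (norm_add_le _ _).trans (add_le_add h1 h2)

end Covariant

end

end Summit.QuantumFields.BalabanUV.T4Continuum.NE3.CurvedLandauGaugeLetters
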